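import Literature.Analysis.FluidPDE.LinearisedNSFourierSolution
import Literature.Analysis.FluidPDE.NavierStokesConcentrationCorrectorProofs
import HarnessLib

/-!
# The linearised Navier–Stokes equation along a smooth field on the flat torus: existence of
# smooth solutions on a compact time interval

Function-space support file (all results proved; no definitions, no named facts), the
EXISTENCE companion of `TorusLinearisedNSEnergy` (energy identity, uniqueness),
`TorusLinearisedNSGrowth`, `TorusLinearisedNSSmoothing`, … . Fix `ν > 0` and a jointly smooth
velocity field `u` on `[a, b] × T^d` (`a < b`) with divergence-free slices. The **linearised
Navier–Stokes equation along `u`** (Constantin–Foias 1988, Ch. 14, (14.3)–(14.4); Temam 1997,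
Ch. VI §3.1, (3.7)–(3.11): `∂ₜU − νΔU + (u·∇)U + (U·∇)u + ∇Π = 0`, `div U = 0`, "possesses a
unique solution"),

`∂ₜw + (u·∇)w + (w·∇)u = νΔw − ∇q`, `div w = 0`,

has, for every smooth divergence-free mean-zero datum `w₀`, a solution `(w, q)` jointly smooth
on `[a, b] × T^d` with `w(a) = w₀`, `w(t)` divergence free and mean zero and `q(t)` mean zero
(`Torus.linearisedNS_exists`). As in the sibling files no predicate is introduced: the clauses
are listed separately, so that any packaged notion (e.g. a summit-side
`IsLinearizedNSSolutionOn (Icc a b) ν u w q`) is fed by `exact ⟨…⟩`. Uniqueness is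
`Torus.linearisedNS_unique` (`TorusLinearisedNSEnergy`).

## Proof road

The solution is the Fourier–Picard construction of `Literature/Analysis/FluidPDE/LinearisedNSFourier*`
(`LinearisedNSFourier.exists_solution_Icc`: mild formulation of the Leray-projected equation on
the frequency lattice, Picard iteration contracting on the whole interval in time-weighted sup
norms, bootstrap of time regularity, synthesis, real parts) on the model interval `[0, b − a]`
for the translated background `u(· + a)`, translated back to `[a, b]`
(`Torus.IsSmoothSpaceTimeOn.comp_sub_const_Icc`, `Torus.timeDerivWithin_comp_sub_const_Icc`).
This is NOT the Galerkin road of Constantin–Foias / Temam; the statement is theirs.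

## References

* P. Constantin, C. Foias, *Navier–Stokes Equations*, Chicago Lectures in Math. (1988), Ch. 14,
  (14.2)–(14.6). [`ConstantinFoiasNSE1988`]
* R. Temam, *Infinite-Dimensional Dynamical Systems in Mechanics and Physics*, 2nd ed., Springer
  (1997), Ch. VI §3.1, (3.7)–(3.11). [`Temam1997`]
-/

open MeasureTheory Set Filter
open scoped InnerProductSpace ContDiff Topology

noncomputable section

namespace Literature.Analysis.FunctionSpaces

namespace Torus

variable {d : Type*} [Fintype d] [DecidableEq d]

variable {ν a b : ℝ} {u : ℝ → UnitAddTorus d → EuclideanSpace ℝ d}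
  {w₀ : UnitAddTorus d → EuclideanSpace ℝ d}

/-- **Existence of smooth solutions of the linearised Navier–Stokes equation on `[a, b] × T^d`.**
For `ν > 0`, `a < b`, a velocity field `u` jointly smooth on `[a, b] × T^d` with divergence-free
slices, and a smooth divergence-free mean-zero datum `w₀`, there are `w`, `q` jointly smooth on
`[a, b] × T^d` such that `w(t)` is divergence free and mean zero, `q(t)` is mean zero,
`∂ₜw + (u·∇)w + (w·∇)u = νΔw − ∇q` holds pointwise on `[a, b]` (one-sided time derivative
`Torus.timeDerivWithin (Icc a b)`), and `w(a) = w₀` (Constantin–Foias 1988, Ch. 14,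
(14.3)–(14.4); Temam 1997, Ch. VI §3.1, (3.11): the linearised problem "possesses a unique
solution" — uniqueness is `Torus.linearisedNS_unique`). Proof: the Fourier–Picard construction
`LinearisedNSFourier.exists_solution_Icc` on `[0, b − a]` for `u(· + a)`, translated in time.
[cite: ConstantinFoiasNSE1988, Ch. 14 (14.3)] -/
theorem linearisedNS_exists (hν : 0 < ν) (hab : a < b) (hu : IsSmoothSpaceTimeOn (Icc a b) u)
    (hudiv : ∀ t ∈ Icc a b, IsDivFree (u t)) (hw₀ : IsSmooth w₀) (hw₀div : IsDivFree w₀)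
    (hw₀mean : HasZeroMean w₀) :
    ∃ (w : ℝ → UnitAddTorus d → EuclideanSpace ℝ d) (q : ℝ → UnitAddTorus d → ℝ),
      IsSmoothSpaceTimeOn (Icc a b) w ∧ IsSmoothSpaceTimeOn (Icc a b) q ∧
      (∀ t ∈ Icc a b, IsDivFree (w t)) ∧ (∀ t ∈ Icc a b, HasZeroMean (w t)) ∧
      (∀ t ∈ Icc a b, HasZeroMean (q t)) ∧
      (∀ t ∈ Icc a b, ∀ x, timeDerivWithin (Icc a b) w t x + convect (u t) (w t) x +
        convect (w t) (u t) x = ν • laplacian (w t) x - gradient (q t) x) ∧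
      w a = w₀ := by
  -- the translated background on the model interval `[0, b - a]`
  set T : ℝ := b - a with hT
  have hT0 : 0 < T := sub_pos.2 hab
  have hpre : (· + a) ⁻¹' Icc a b = Icc 0 T := by
    rw [Literature.Analysis.FluidPDE.Torus.preimage_add_const_Icc', sub_self]
  set uτ : ℝ → UnitAddTorus d → EuclideanSpace ℝ d := fun s => u (s + a) with huτ
  have huτs : IsSmoothSpaceTimeOn (Icc 0 T) uτ := by
    have h1 := hu.comp_add_const a
    rwa [hpre] at h1
  have hmem : ∀ s ∈ Icc 0 T, s + a ∈ Icc a b := fun s hs =>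
    ⟨by linarith [hs.1], by linarith [hs.2]⟩
  have hdivτ : ∀ s ∈ Icc 0 T, IsDivFree (uτ s) := fun s hs => hudiv (s + a) (hmem s hs)
  -- the solution on the model interval and its translation
  obtain ⟨h1, h2, h3, h4, h5, h6, h7⟩ :=
    FluidPDE.LinearisedNSFourier.vel_isSolution hν hT0 huτs hdivτ hw₀ hw₀div hw₀mean
  set v := FluidPDE.LinearisedNSFourier.vel ν T uτ w₀ with hv
  set p := FluidPDE.LinearisedNSFourier.pres ν T uτ w₀ with hp
  have hb : a + T = b := by rw [hT]; ring
  have hsub : ∀ t ∈ Icc a b, t - a ∈ Icc 0 T := fun t ht => ⟨by linarith [ht.1], by linarith [ht.2]⟩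
  refine ⟨fun t => v (t - a), fun t => p (t - a), ?_, ?_, fun t ht => h3 (t - a) (hsub t ht),
    fun t ht => h4 (t - a) (hsub t ht), fun t ht => h5 (t - a) (hsub t ht), fun t ht x => ?_, ?_⟩
  · have h := h1.comp_sub_const_Icc (a := a)
    rwa [hb] at h
  · have h := h2.comp_sub_const_Icc (a := a)
    rwa [hb] at h
  · have hm := h6 (t - a) (hsub t ht) x
    simp only [huτ, sub_add_cancel] at hm
    have hd := Literature.Analysis.FluidPDE.Torus.timeDerivWithin_comp_sub_const_Icc T a v t x
    rw [hb] at hd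
    rw [hd]
    exact hm
  · change v (a - a) = w₀
    rw [sub_self]
    exact h7

end Torus

end Literature.Analysis.FunctionSpaces

end
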